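import Summits.BirchSwinnertonDyer.BirchSwinnertonDyer.Theorems.ResidualThetaTransportAtTwoSignedMuVanishingAtTwoPlusCuspSpanGroupNamed
import Mathlib.LinearAlgebra.Matrix.FixedDetMatrices
import HarnessLib

/-!
# Route `ResidualThetaTransportAtTwo`, crux Kμ⁺ `SignedMuVanishingAtTwoPlus` (stmt-BirchSwinnertonDyer-20689), line
# `birth`, stub `stub_flatMuZeroAtTwo`: a KERNEL CERTIFICATE FORMAT for the node at one level — Schreier's lemma along a
# finite coset table, and the soundness of `E/D`-factorisation lists

Cell `bsd-wall`, width seat `bsd-wall-rtt-p4-w2` (g5). THEOREMS ONLY (no `def`, no named fact, no `sorry`); helper `--supports`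
the crux; closes nothing; BSD is not proved by this. Purpose: make the membership form of the node,
`Gamma1' N ≤ M_N` (`…CuspSpanGamma1`, w3 g3: `M_N` = the subgroup of `Γ₀(N)` generated by the elements of trace `0, ±1, ±2`, the
elements with lower-right entry `±4^k`, the squares and the commutators; ⟹ `CuspSpanEvenAtTwo N` by
`cuspSpanEvenAtTwo_of_gamma1_le_closure`), CERTIFIABLE level by level in the kernel from finite data checked by `decide`:

* §1 `SL(2, ℤ)` is generated by `S, T` as a MONOID (`S⁻¹ = S³`, `T⁻¹ = S³ T S T S`), so inductions over products of `S, T`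
  (no inverses) reach every element (`sl2z_submonoid_closure_eq_top`).
* §2 **Schreier's lemma along a table** (`mem_of_schreier_table`): `G` acting on the right on `X`, a set of «states» with a
  vector `vec σ ∈ X`, a successor `step σ s` for the generators and a label `R σ ∈ G`; if every step is compatible with the action
  and every Schreier element `R σ · s · R(step σ s)⁻¹` lies in `K`, and states over the base vector have label in `K`, then the
  stabiliser of the base vector is contained in `K`. (For `X = (ℤ/N)²` row vectors and base `(0, 1)` the stabiliser is `Γ₁'(N)`.)
* §3 Entries of products / inverses in `SL(2, ℤ)` and of the row action on `(ZMod N)²`.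
* §4 **Soundness of factorisation lists** (`mem_of_factorList`): if the integer quadruple of `g ∈ SL(2, ℤ)` is the product of a list
  of quadruples each of which is (the inverse of) an element of `Γ₀(N)` of trace `0, ±1, ±2` or with lower-right entry of absolute
  value in `{4, 16, …, 4¹⁰}`, then `g ∈ K` for every subgroup `K` containing those elements.
The assembly into one certificate theorem is `…CuspSpanCertTable` (`gamma1_le_closure_of_certTable`); the per-level data
(transversal, successor table, factorisations — found by a best-first search) live in the level files (`…CuspSpanCert35`).

References: O. Schreier, Abh. Math. Sem. Hamburg 5 (1927) 161–183 (Schreier generators); A. W. Knapp, *Elliptic curves*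
(1992) Prop. 11.22 [Knapp1993]; R. Pollack, Duke Math. J. 118 (2003) Conj. 6.3 [Pollack2003].
-/

set_option autoImplicit false
set_option linter.dupNamespace false

open scoped MatrixGroups

open CongruenceSubgroup Matrix.SpecialLinearGroup ModularGroup

namespace Summit.BirchSwinnertonDyer.BirchSwinnertonDyer.Theorems.SignedMuAtTwo

/-! ## §1. `SL(2, ℤ)` as a monoid on `S, T` -/

section Monoid

/-- Entries of a product in `SL(2, ℤ)`. [folklore] -/
theorem sl2_mul_apply (g h : SL(2, ℤ)) :
    (g * h) 0 0 = g 0 0 * h 0 0 + g 0 1 * h 1 0 ∧ (g * h) 0 1 = g 0 0 * h 0 1 + g 0 1 * h 1 1 ∧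
      (g * h) 1 0 = g 1 0 * h 0 0 + g 1 1 * h 1 0 ∧ (g * h) 1 1 = g 1 0 * h 0 1 + g 1 1 * h 1 1 := by
  refine ⟨?_, ?_, ?_, ?_⟩ <;> rw [coe_mul] <;> simp [Matrix.mul_apply, Fin.sum_univ_two]

/-- Entries of an inverse in `SL(2, ℤ)`. [folklore] -/
theorem sl2_inv_apply (g : SL(2, ℤ)) :
    g⁻¹ 0 0 = g 1 1 ∧ g⁻¹ 0 1 = -g 0 1 ∧ g⁻¹ 1 0 = -g 1 0 ∧ g⁻¹ 1 1 = g 0 0 := by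
  rw [Matrix.SpecialLinearGroup.SL2_inv_expl]
  exact ⟨rfl, rfl, rfl, rfl⟩

/-- Two elements of `SL(2, ℤ)` with the same four entries are equal. [folklore] -/
theorem sl2_ext {g h : SL(2, ℤ)} (h00 : g 0 0 = h 0 0) (h01 : g 0 1 = h 0 1) (h10 : g 1 0 = h 1 0)
    (h11 : g 1 1 = h 1 1) : g = h := by
  ext i j
  fin_cases i <;> fin_cases j
  · exact h00
  · exact h01
  · exact h10
  · exact h11

/-- `S⁻¹ = S³`. [folklore] -/
theorem S_inv_eq_cube : (S : SL(2, ℤ))⁻¹ = S * S * S := by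
  have hS := sl2_mul_apply S S
  have hSS := sl2_mul_apply (S * S) S
  have hi := sl2_inv_apply S
  have e : ∀ i j : Fin 2, (S : SL(2, ℤ)) i j = !![(0 : ℤ), -1; 1, 0] i j := fun i j ↦ by rw [← coe_S]
  apply sl2_ext
  · rw [hi.1, hSS.1, hS.1, hS.2.1]; simp [e]
  · rw [hi.2.1, hSS.2.1, hS.1, hS.2.1]; simp [e]
  · rw [hi.2.2.1, hSS.2.2.1, hS.2.2.1, hS.2.2.2]; simp [e]
  · rw [hi.2.2.2, hSS.2.2.2, hS.2.2.1, hS.2.2.2]; simp [e]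

/-- `T⁻¹ = S³ T S T S` (from `(ST)³ = −1`). [folklore] -/
theorem T_inv_eq_word : (T : SL(2, ℤ))⁻¹ = S * S * S * T * S * T * S := by
  have e : ∀ i j : Fin 2, (S : SL(2, ℤ)) i j = !![(0 : ℤ), -1; 1, 0] i j := fun i j ↦ by rw [← coe_S]
  have f : ∀ i j : Fin 2, (T : SL(2, ℤ)) i j = !![(1 : ℤ), 1; 0, 1] i j := fun i j ↦ by rw [← coe_T]
  have h2 := sl2_mul_apply S S
  have h3 := sl2_mul_apply (S * S) S
  have h4 := sl2_mul_apply (S * S * S) T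
  have h5 := sl2_mul_apply (S * S * S * T) S
  have h6 := sl2_mul_apply (S * S * S * T * S) T
  have h7 := sl2_mul_apply (S * S * S * T * S * T) S
  have hi := sl2_inv_apply T
  apply sl2_ext
  · rw [hi.1, h7.1, h6.1, h6.2.1, h5.1, h5.2.1, h4.1, h4.2.1, h3.1, h3.2.1, h2.1, h2.2.1]; simp [e, f]
  · rw [hi.2.1, h7.2.1, h6.1, h6.2.1, h5.1, h5.2.1, h4.1, h4.2.1, h3.1, h3.2.1, h2.1, h2.2.1]; simp [e, f]
  · rw [hi.2.2.1, h7.2.2.1, h6.2.2.1, h6.2.2.2, h5.2.2.1, h5.2.2.2, h4.2.2.1, h4.2.2.2, h3.2.2.1, h3.2.2.2,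
      h2.2.2.1, h2.2.2.2]; simp [e, f]
  · rw [hi.2.2.2, h7.2.2.2, h6.2.2.1, h6.2.2.2, h5.2.2.1, h5.2.2.2, h4.2.2.1, h4.2.2.2, h3.2.2.1, h3.2.2.2,
      h2.2.2.1, h2.2.2.2]; simp [e, f]

/-- **`SL(2, ℤ)` is generated by `S` and `T` as a monoid** (no inverses needed). [folklore] -/
theorem sl2z_submonoid_closure_eq_top : Submonoid.closure ({S, T} : Set SL(2, ℤ)) = ⊤ := by
  apply top_le_iff.mp
  have h1 : (Subgroup.closure ({S, T} : Set SL(2, ℤ))).toSubmonoid = ⊤ := by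
    rw [SpecialLinearGroup.SL2Z_generators]; rfl
  rw [Subgroup.closure_toSubmonoid] at h1
  rw [← h1]
  refine (Submonoid.closure_le.mpr ?_)
  rintro g (hg | hg)
  · exact Submonoid.subset_closure hg
  · rw [Set.mem_inv] at hg
    have hS : (S : SL(2, ℤ)) ∈ Submonoid.closure ({S, T} : Set SL(2, ℤ)) :=
      Submonoid.subset_closure (Set.mem_insert S {T})
    have hT : (T : SL(2, ℤ)) ∈ Submonoid.closure ({S, T} : Set SL(2, ℤ)) :=
      Submonoid.subset_closure (Set.mem_insert_of_mem S rfl)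
    rcases hg with h | h
    · have : g = S * S * S := by rw [← inv_inv g, h, S_inv_eq_cube]
      rw [this]
      exact mul_mem (mul_mem hS hS) hS
    · have h' : g⁻¹ = T := h
      have : g = S * S * S * T * S * T * S := by rw [← inv_inv g, h', T_inv_eq_word]
      rw [this]
      exact mul_mem (mul_mem (mul_mem (mul_mem (mul_mem (mul_mem hS hS) hS) hT) hS) hT) hS

end Monoid

/-! ## §2. Schreier's lemma along a finite table -/

section Schreier

/-- **Schreier's lemma along a table.** Let `G` act on the right on `X` (`ρ`), generated as a monoid by `Sset`. Let `Σ` be a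
type of states with a predicate `good`, a vector `vec : Σ → X`, a successor `step : Σ → G → Σ` and a label `R : Σ → G`, and
`K ≤ G`. Suppose: for every good `σ` and `s ∈ Sset`, `step σ s` is good, `vec (step σ s) = ρ (vec σ) s`, and the Schreier element
`R σ * s * (R (step σ s))⁻¹ ∈ K`; and every good `σ` with `vec σ = vec σ₀` has `R σ ∈ K`. Then every `g` fixing `vec σ₀` lies in
`K` (induction over `g` as a product of generators: there is a good state `σ` with `vec σ = ρ (vec σ₀) g` and `g (R σ)⁻¹ ∈ K`).
[folklore] -/
theorem mem_of_schreier_table {G : Type*} [Group G] {X St : Type*} (ρ : X → G → X)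
    (hmul : ∀ x (g h : G), ρ x (g * h) = ρ (ρ x g) h) (hone : ∀ x, ρ x 1 = x)
    {Sset : Set G} (hS : Submonoid.closure Sset = ⊤)
    (good : St → Prop) (vec : St → X) (step : St → G → St) (R : St → G) (K : Subgroup G) (σ₀ : St)
    (hgood₀ : good σ₀)
    (hstep : ∀ σ, good σ → ∀ s ∈ Sset,
      good (step σ s) ∧ vec (step σ s) = ρ (vec σ) s ∧ R σ * s * (R (step σ s))⁻¹ ∈ K)
    (hbase : ∀ σ, good σ → vec σ = vec σ₀ → R σ ∈ K)
    {g : G} (hg : ρ (vec σ₀) g = vec σ₀) : g ∈ K := by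
  have key : ∀ g : G, ∃ σ, good σ ∧ vec σ = ρ (vec σ₀) g ∧ g * (R σ)⁻¹ ∈ K := by
    intro g
    induction g using Submonoid.induction_of_closure_eq_top_right hS with
    | one => exact ⟨σ₀, hgood₀, (hone _).symm, by rw [one_mul]; exact K.inv_mem (hbase σ₀ hgood₀ rfl)⟩
    | mul_right x s hs ih =>
      obtain ⟨σ, hσ, hv, hx⟩ := ih
      obtain ⟨hg', hv', hK⟩ := hstep σ hσ s hs
      refine ⟨step σ s, hg', by rw [hv', hv, hmul], ?_⟩
      have : x * s * (R (step σ s))⁻¹ = (x * (R σ)⁻¹) * (R σ * s * (R (step σ s))⁻¹) := by group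
      rw [this]
      exact K.mul_mem hx hK
  obtain ⟨σ, hσ, hv, hK⟩ := key g
  rw [hg] at hv
  have hR := hbase σ hσ hv
  have : g = (g * (R σ)⁻¹) * R σ := by group
  rw [this]
  exact K.mul_mem hK hR

end Schreier

/-! ## §3. The row action of `SL(2, ℤ)` on `(ZMod N)²` -/

section Row

variable {N : ℕ}

/-- Row action, product rule (first coordinate). [folklore] -/
theorem row_mul_fst (v₁ v₂ : ZMod N) (g h : SL(2, ℤ)) :
    v₁ * (((g * h) 0 0 : ℤ) : ZMod N) + v₂ * (((g * h) 1 0 : ℤ) : ZMod N) =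
      (v₁ * ((g 0 0 : ℤ) : ZMod N) + v₂ * ((g 1 0 : ℤ) : ZMod N)) * ((h 0 0 : ℤ) : ZMod N) +
        (v₁ * ((g 0 1 : ℤ) : ZMod N) + v₂ * ((g 1 1 : ℤ) : ZMod N)) * ((h 1 0 : ℤ) : ZMod N) := by
  have h4 := sl2_mul_apply g h
  rw [h4.1, h4.2.2.1]; push_cast; ring

/-- Row action, product rule (second coordinate). [folklore] -/
theorem row_mul_snd (v₁ v₂ : ZMod N) (g h : SL(2, ℤ)) :
    v₁ * (((g * h) 0 1 : ℤ) : ZMod N) + v₂ * (((g * h) 1 1 : ℤ) : ZMod N) =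
      (v₁ * ((g 0 0 : ℤ) : ZMod N) + v₂ * ((g 1 0 : ℤ) : ZMod N)) * ((h 0 1 : ℤ) : ZMod N) +
        (v₁ * ((g 0 1 : ℤ) : ZMod N) + v₂ * ((g 1 1 : ℤ) : ZMod N)) * ((h 1 1 : ℤ) : ZMod N) := by
  have h4 := sl2_mul_apply g h
  rw [h4.2.1, h4.2.2.2]; push_cast; ring

end Row

/-! ## §4. Soundness of `E/D` factorisation lists -/

section Factor

variable {N : ℕ}

/-- **An element of `SL(2, ℤ)` tagged `E` or `D` lies in `K`**: if `N ∣ c` and either the trace has absolute value `≤ 2` or the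
lower-right entry has absolute value `4, 16, …, 4¹⁰`, and `K` contains all such elements of `Γ₀(N)`. [folklore] -/
theorem mem_of_tag (K : Subgroup SL(2, ℤ))
    (hE : ∀ g : SL(2, ℤ), (N : ℤ) ∣ g 1 0 → (g 0 0 + g 1 1).natAbs ≤ 2 → g ∈ K)
    (hD : ∀ g : SL(2, ℤ), (N : ℤ) ∣ g 1 0 → (∃ k : ℕ, 1 ≤ k ∧ (g 1 1).natAbs = 4 ^ k) → g ∈ K)
    (m : SL(2, ℤ)) (hc : (N : ℤ) ∣ m 1 0)
    (htag : (m 0 0 + m 1 1).natAbs ≤ 2 ∨ (m 1 1).natAbs ∈ [4, 16, 64, 256, 1024, 4096, 16384, 65536, 262144, 1048576]) : m ∈ K := by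
  rcases htag with h | h
  · exact hE _ hc h
  · refine hD _ hc ?_
    simp only [List.mem_cons, List.mem_nil_iff, or_false] at h
    rcases h with h | h | h | h | h | h | h | h | h | h
    · exact ⟨1, le_refl _, by rw [h]; norm_num⟩
    · exact ⟨2, by norm_num, by rw [h]; norm_num⟩
    · exact ⟨3, by norm_num, by rw [h]; norm_num⟩
    · exact ⟨4, by norm_num, by rw [h]; norm_num⟩
    · exact ⟨5, by norm_num, by rw [h]; norm_num⟩
    · exact ⟨6, by norm_num, by rw [h]; norm_num⟩
    · exact ⟨7, by norm_num, by rw [h]; norm_num⟩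
    · exact ⟨8, by norm_num, by rw [h]; norm_num⟩
    · exact ⟨9, by norm_num, by rw [h]; norm_num⟩
    · exact ⟨10, by norm_num, by rw [h]; norm_num⟩

/-- **Soundness of a factorisation list.** Let `F` be a list of pairs `(ι, (a, b, c, d))` of a flag and an integer quadruple, each
quadruple of determinant `1`, with `N ∣ c`, and of trace `0, ±1, ±2` or with `|d| ∈ {4, …, 4¹⁰}`; read `(ι, q)` as the matrix `q` if
`ι = false` and as `q⁻¹` if `ι = true`. If the entries of `g ∈ SL(2, ℤ)` are the (left-to-right) product of the list, then `g ∈ K`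
for every subgroup `K` containing the small-trace and the `4^k`-elements of `Γ₀(N)`. (The product is the `List.foldl` of the
quadruple multiplication spelled inline; this is what `decide` checks in the level files.) [folklore] -/
theorem mem_of_factorList (K : Subgroup SL(2, ℤ))
    (hE : ∀ g : SL(2, ℤ), (N : ℤ) ∣ g 1 0 → (g 0 0 + g 1 1).natAbs ≤ 2 → g ∈ K)
    (hD : ∀ g : SL(2, ℤ), (N : ℤ) ∣ g 1 0 → (∃ k : ℕ, 1 ≤ k ∧ (g 1 1).natAbs = 4 ^ k) → g ∈ K)
    (F : List (Bool × ℤ × ℤ × ℤ × ℤ))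
    (hF : ∀ f ∈ F, f.2.1 * f.2.2.2.2 - f.2.2.1 * f.2.2.2.1 = 1 ∧ (N : ℤ) ∣ f.2.2.2.1 ∧
      ((f.2.1 + f.2.2.2.2).natAbs ≤ 2 ∨ (f.2.2.2.2).natAbs ∈ [4, 16, 64, 256, 1024, 4096, 16384, 65536, 262144, 1048576])) :
    ∀ (g₀ g : SL(2, ℤ)), g₀ ∈ K →
      ((g 0 0 : ℤ), (g 0 1 : ℤ), (g 1 0 : ℤ), (g 1 1 : ℤ)) =
        F.foldl (fun (acc : ℤ × ℤ × ℤ × ℤ) (f : Bool × ℤ × ℤ × ℤ × ℤ) ↦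
          if f.1 then
            (acc.1 * f.2.2.2.2 + acc.2.1 * (-f.2.2.2.1), acc.1 * (-f.2.2.1) + acc.2.1 * f.2.1,
              acc.2.2.1 * f.2.2.2.2 + acc.2.2.2 * (-f.2.2.2.1), acc.2.2.1 * (-f.2.2.1) + acc.2.2.2 * f.2.1)
          else
            (acc.1 * f.2.1 + acc.2.1 * f.2.2.2.1, acc.1 * f.2.2.1 + acc.2.1 * f.2.2.2.2,
              acc.2.2.1 * f.2.1 + acc.2.2.2 * f.2.2.2.1, acc.2.2.1 * f.2.2.1 + acc.2.2.2 * f.2.2.2.2))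
          ((g₀ 0 0 : ℤ), (g₀ 0 1 : ℤ), (g₀ 1 0 : ℤ), (g₀ 1 1 : ℤ)) → g ∈ K := by
  induction F with
  | nil =>
    intro g₀ g hg₀ h
    simp only [List.foldl_nil, Prod.mk.injEq] at h
    have : g = g₀ := sl2_ext h.1 h.2.1 h.2.2.1 h.2.2.2
    rw [this]; exact hg₀
  | cons f F ih =>
    intro g₀ g hg₀ h
    obtain ⟨hdet, hc, htag⟩ := hF f (List.mem_cons_self)
    have hF' : ∀ f' ∈ F, f'.2.1 * f'.2.2.2.2 - f'.2.2.1 * f'.2.2.2.1 = 1 ∧ (N : ℤ) ∣ f'.2.2.2.1 ∧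
        ((f'.2.1 + f'.2.2.2.2).natAbs ≤ 2 ∨ (f'.2.2.2.2).natAbs ∈ [4, 16, 64, 256, 1024, 4096, 16384, 65536, 262144, 1048576]) :=
      fun f' hf' ↦ hF f' (List.mem_cons_of_mem _ hf')
    -- the factor as an element of `SL(2, ℤ)`
    set m : SL(2, ℤ) := ⟨!![f.2.1, f.2.2.1; f.2.2.2.1, f.2.2.2.2], by
      rw [Matrix.det_fin_two_of]; linear_combination hdet⟩ with hm
    have hm00 : m 0 0 = f.2.1 := rfl
    have hm01 : m 0 1 = f.2.2.1 := rfl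
    have hm10 : m 1 0 = f.2.2.2.1 := rfl
    have hm11 : m 1 1 = f.2.2.2.2 := rfl
    have hmK : m ∈ K := mem_of_tag K hE hD m (by rw [hm10]; exact hc) (by rw [hm00, hm11]; exact htag)
    rw [List.foldl_cons] at h
    by_cases hι : f.1 = true
    · -- factor `m⁻¹`
      refine ih hF' (g₀ * m⁻¹) g (K.mul_mem hg₀ (K.inv_mem hmK)) ?_
      rw [h, if_pos hι]
      have h4 := sl2_mul_apply g₀ m⁻¹
      have hi := sl2_inv_apply m
      rw [h4.1, h4.2.1, h4.2.2.1, h4.2.2.2, hi.1, hi.2.1, hi.2.2.1, hi.2.2.2, hm00, hm01, hm10, hm11]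
    · refine ih hF' (g₀ * m) g (K.mul_mem hg₀ hmK) ?_
      rw [h, if_neg hι]
      have h4 := sl2_mul_apply g₀ m
      rw [h4.1, h4.2.1, h4.2.2.1, h4.2.2.2, hm00, hm01, hm10, hm11]

end Factor

end Summit.BirchSwinnertonDyer.BirchSwinnertonDyer.Theorems.SignedMuAtTwo
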